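import Summits.QuantumFields.YangMills.Theorems.ConvexGribovBodyCovarianceBoundTwistReduction
import HarnessLib

/-!
# Skeleton line `Sketch` (ideator 4: twist-stiffness envelope) for crux `CovarianceBound` (stmt-QuantumFields-8780),
# route `QuantumFields/YangMills/ConvexGribovBody` — v3 (continuation lead c4, 2026-08-17; stubs 1–3 and the p = 0 composition LANDED)

IDEA (card `Cruxes/CovarianceBound/Ideas/twist-stiffness-envelope.md`). The slice Coulomb functional is a `G`-valued gauge
glass; the `p = 0` `𝔤`-mode of the minimal-Coulomb-gauge gluon field is the cone slope of its twist-energy class function.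
Deterministically, at an absolute minimiser `h` and for every one-parameter generator `X ∈ 𝔤` (`r.lieAlgCarrier`),
`zeroModePair² ≤ 2 (L³ ‖X‖²_F) · twistGap` (`stub_coneInequality`: boosting every `j`-link by `exp(sX/L)` is a twisted
quasi-periodic gauge transformation, so absolute minimality bounds the boosted energy below by `perMin − twistGap`, while a
second-order Taylor bound caps it above by `perMin + s·zeroModePair/L + s²L‖X‖²_F/2`; optimise in `s`). Finitely many carrier
directions control `‖P_𝔤 ·‖²_F` (`stub_lieProjControl`), the twist gap is a bounded Borel function of `U`
(`stub_twistGapMeasurable`), so the MEASURE-side transfer `stub_meanTwistGapBound` (`E_μ twistGap ≤ D`, the defect energy of the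
Coulomb gauge glass is `O(1)` at `β ≥ β₀` uniformly in the volume — OPEN, numerically true at β = 0, undecided at β = 2.3) gives
`LieModeBoundZero` (`lieModeBoundZero_of_twist`, proved below). The landed momentum trichotomy
(`covarianceBound_of_zero_pos_perp`, p137286) places it: the remaining inputs are `stub_lieModeBoundPos` (the `p ≠ 0` bulk of
the `𝔤`-half — HONESTLY A PIECE OF THE CRUX: Gribov–Zwanziger infrared finiteness proper, no lever on record) and
`stub_perpModeBound` (the `𝔤^⊥`-half — a piece of the crux, void for `SU(2)`-type `r` by `supPerpCosSq_fundamental_two_eq_zero`,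
p115526). The line covers `p = 0`; it does not claim the crux.

DISPROOF USED (`Cruxes/CovarianceBound/Disproof.lean` v2): §A minimality is load-bearing — every inequality here is absolute
minimality against an explicit competitor (twisted transformations); §A′ `toron_tight` — the spread toron is the equality case of
the cone inequality up to constants (no configuration-wise claim is made: the factor `L` is the measure's, carried by
`stub_meanTwistGapBound`); §C — boosts act on `𝔤` only, hence the separate `stub_perpModeBound`.

Vocabulary: `…CovarianceBoundDefs/DefsB` (`coulombF`, `IsCoulMin`, `gluon`, `froSq`, `cosMode`, `lieCosMode`, `supLieCosSq`,
`wilson4`, `LatticeRep.lieAlgCarrier/lieProj`), `…DefsC` (`twistedCoulombF`, `perMin`, `twistMin`, `twistGap`, `zeroModePair`),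
`…MomentReduction/MomentumSplit` (`LieModeBoundZero/Pos`, `PerpModeBound`, glue).

STATE v3: stubs 1–3 have LANDED — `stub_coneInequality` (p138191, `…StubConeInequality`, lead), `stub_lieProjControl`
(p137962, `…StubLieProjControl`, wave 1), `stub_twistGapMeasurable` (p137844, `…StubTwistGapMeasurable`, wave 1) — and so has
the `p = 0` composition (`…TwistReduction`, p138507: `def MeanTwistGapBound`, unconditional `exists_supLieCosSq_zero_le`,
`lieModeBoundZero_of_meanTwistGapBound`, `covarianceBound_of_meanTwistGap_pos_perp`) and the tightness record (`…ToronSharp`,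
p138779 submitted: the cone inequality is asymptotically sharp on the spread toron). `sorry` remains only in
`stub_meanTwistGapBound` (OPEN transfer), `stub_lieModeBoundPos`, `stub_perpModeBound` (pieces of the crux); `CovarianceBound_of`
is the landed `covarianceBound_of_meanTwistGap_pos_perp`.
-/

set_option autoImplicit false

noncomputable section

namespace Summit.QuantumFields.YangMills.Cruxes.CovarianceBound.TwistStiffness

open scoped BigOperators Matrix ComplexConjugate
open MeasureTheory Literature.MathematicalPhysics.QuantumFieldTheory
open Summit.QuantumFields.YangMills.Cruxes.CovarianceBound.SupportWindow

variable {G : Type} [Group G] [TopologicalSpace G]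

/-! ### Registered stubs (`sorry` lives ONLY in `stub_*`) -/

/-- **Stub 4 — mean twist-gap bound** (the line's measure-side TRANSFER; OPEN): the Wilson average of the twist gap is
bounded uniformly in the volume at `β ≥ β₀` (stiffness exponent `θ_s ≤ 0` of the Coulomb gauge glass in b.c.-optimised
defect-energy language). -/
theorem stub_meanTwistGapBound :
    ∀ (G : Type) [Group G] [TopologicalSpace G] [IsTopologicalGroup G] [CompactSpace G]
      [MeasurableSpace G] [BorelSpace G], IsCompactSimpleLieGroup G → ∀ r : LatticeRep G,
      ∃ β₀ : ℝ, ∀ β : ℝ, β₀ ≤ β → ∃ D : ℝ, 0 < D ∧ ∃ S₀ : ℕ, ∀ S : ℕ, S₀ ≤ S →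
        ∀ j : Fin 3, ∫ U, twistGap r S j U ∂(wilson4 r β S) ≤ D := by
  sorry

/-- **Stub 5 — the `p ≠ 0` bulk of the `𝔤`-half** (OPEN; HONESTLY A PIECE OF THE CRUX — `LieModeBoundPos` of
`…MomentumSplit`: Gribov–Zwanziger infrared finiteness proper; this line claims no mechanism for it). -/
theorem stub_lieModeBoundPos :
    ∀ (G : Type) [Group G] [TopologicalSpace G] [IsTopologicalGroup G] [CompactSpace G]
      [MeasurableSpace G] [BorelSpace G], IsCompactSimpleLieGroup G → ∀ r : LatticeRep G,
      ∃ β₀ : ℝ, ∀ β : ℝ, β₀ ≤ β → ∃ D : ℝ, 0 < D ∧ ∃ S₀ : ℕ, ∀ S : ℕ, S₀ ≤ S →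
        ∀ (p : Fin 3 → ZMod (2 * S + 1)) (j : Fin 3), p ≠ 0 →
          ∫ U, supLieCosSq r S p j U ∂(wilson4 r β S) ≤ D * (2 * S + 1 : ℝ) ^ 3 := by
  sorry

/-- **Stub 6 — the `𝔤^⊥`-half** (OPEN in general; A PIECE OF THE CRUX — `PerpModeBound` of `…MomentReduction`; void for
representations with `½(ρg − (ρg)ᴴ) ∈ 𝔤`, e.g. `SU(2)` fundamental, p115526). -/
theorem stub_perpModeBound :
    ∀ (G : Type) [Group G] [TopologicalSpace G] [IsTopologicalGroup G] [CompactSpace G]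
      [MeasurableSpace G] [BorelSpace G], IsCompactSimpleLieGroup G → ∀ r : LatticeRep G,
      ∃ β₀ : ℝ, ∀ β : ℝ, β₀ ≤ β → ∃ D : ℝ, 0 < D ∧ ∃ S₀ : ℕ, ∀ S : ℕ, S₀ ≤ S →
        ∀ (p : Fin 3 → ZMod (2 * S + 1)) (j : Fin 3),
          ∫ U, supPerpCosSq r S p j U ∂(wilson4 r β S) ≤ D * (2 * S + 1 : ℝ) ^ 3 := by
  sorry

/-! ### Name-keyed statements of the stubs (hypotheses of the composition) -/
namespace Registered

/-- Statement of `stub_meanTwistGapBound` (= the landed `MeanTwistGapBound` of `…TwistReduction`). -/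
abbrev stub_meanTwistGapBound : Prop := MeanTwistGapBound

/-- Statement of `stub_lieModeBoundPos` (= `LieModeBoundPos`). -/
abbrev stub_lieModeBoundPos : Prop := LieModeBoundPos

/-- Statement of `stub_perpModeBound` (= `PerpModeBound`). -/
abbrev stub_perpModeBound : Prop := PerpModeBound

end Registered

/-! ### The composition keyed by the registered stub names (skeleton-check entry point) -/

/-- `CovarianceBound_of` — stub 4 (with the landed stubs 1–3, `lieModeBoundZero_of_meanTwistGapBound`) ⇒ `LieModeBoundZero`;
with stubs 5–6 the landed momentum trichotomy concludes the crux: this IS the landed theorem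
`covarianceBound_of_meanTwistGap_pos_perp` (p138507). -/
theorem CovarianceBound_of (hD : Registered.stub_meanTwistGapBound)
    (hE : Registered.stub_lieModeBoundPos) (hF : Registered.stub_perpModeBound) :
    Summit.QuantumFields.YangMills.Theses.ConvexGribovBody.CovarianceBound :=
  covarianceBound_of_meanTwistGap_pos_perp hD hE hF

/-- **`CovarianceBound_closed`** — the composition fed with the three remaining registered (sorried) stubs. -/
theorem CovarianceBound_closed :
    Summit.QuantumFields.YangMills.Theses.ConvexGribovBody.CovarianceBound :=
  CovarianceBound_of stub_meanTwistGapBound stub_lieModeBoundPos stub_perpModeBound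

end Summit.QuantumFields.YangMills.Cruxes.CovarianceBound.TwistStiffness

end
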